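import Mathlib
import Literature.MathematicalPhysics.QuantumFieldTheory.Balaban1983to89.B8Eq194CriterionCarriers
import Literature.MathematicalPhysics.QuantumFieldTheory.Balaban1983to89.B9BlockSystemSigma

/-!
# [B8] (1.91) vs [4] (3.163) on the d-dimensional carriers: NON-VACUITY and the packaged failing cases
# (cell GAPS G-B8-19 (c), part 6b: the cubes of [5] (2) / [4] (3.18)–(3.19) with axis-by-axis contours form an
# `IsBlockSystem` for the box and torus bond sets of `B8Eq194CriterionCarriers`; the (3.25)-data exist; H′ ≠ H′₍₄₎)

statement-level skeleton of published theorems with citation tags; proofs where landed; nothing here is a claim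
about the Yang–Mills mass gap

Seat p40 gen 9, Phase 2, B8 lane; sibling of `B8Eq194CriterionCarriers` (part 6; read its docstring and part 1's
CONTEXT / ERRATUM / HONEST SCOPE first).  Kind: located reading note, constants only — NOT an error of either paper.

WHY.  Part 6 quantifies over ANY contours Γ / centres y and ANY (3.25)-data on the box/torus carriers ι → Fin (LK).
This file shows the hypotheses are inhabited by the printed geometry: transporting the d-dimensional one-level cube
system of `B9BlockSystemCubes` (sites = (block index c, in-block offset r), corner centres, contours filled axis by
axis — pub-balaban pass 15, `isBlockSystem_cubes`) along the global coordinates x_i = c_i·L + r_i to the carriers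
Fin d → Fin (LK) of part 6 gives an `IsBlockSystem` for `boxBonds` (every intra-cube step ⟨(c,r), (c, r + e_μ)⟩ is a
box bond ⟨x, x + e_μ⟩) and, by monotonicity in the bond set, for `torusBonds`; hence part 4's `exists_data_flat`
yields the (3.25)-data, and part 6's classifications give, with NO hypothesis left, data on which (1.91)'s H′ differs
from [4]'s (3.163) whenever L ≥ 2 and K ≥ 2 (torus: except (L, K) = (2, 2)), in every dimension d ≥ 1.

CONTENT.
§1 GLOBAL COORDINATES (L = l + 1, N = `nSide K l` = (l + 1)·K): `toSite (c, r) = (c_i L + r_i)_i`, `toPair` (block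
   index = part 6's `boxBlk`, offset = remainder), `boxBlk_toSite`, `toPair_toSite`, `toSite_toPair`, `toSite_bond`
   (cube bonds ↦ box bonds); centres `yBox c = toSite (c, 0)` and contours `ΓBox c x` = the image of
   `B9BlockSystemCubes.pathC`.
§2 **`isBlockSystem_box`**, **`isBlockSystem_torus`** (uniform weights κ ≠ 0, blocks `blocksOf (boxBlk L K)`; the torus
   by pub-balaban's `B9BlockSystemSigma.isBlockSystem_mono`, bonds enter only the chain condition);
   **`exists_data_box`**, **`exists_data_torus`** (the (3.25)-data with a = diag(a_c), a_c > 0, exist).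
§3 PACKAGED: `Hp_ne_H4_box` / `Hp_ne_H4_torus` (for EVERY data with diagonal a, a_c ≠ 0: ∃ μ, H′μ ≠ H′₍₄₎μ, when
   L ≥ 2, K ≥ 2 [torus: and (L, K) ≠ (2, 2)]) and the hypothesis-free **`exists_data_Hp_ne_H4_box`** /
   **`exists_data_Hp_ne_H4_torus`** (such data exist for the printed cube geometry, every d ≥ 1); gen 7's hand-built
   six-site `B8Eq194FirstTerm.Witness6` is the instance d = 1, (L, K) = (3, 2) of the torus statement.

HONEST SCOPE.  As in parts 1–6 (scalar fibre, flat background, uniform block weights, unit bond weights); the ORDER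
of the axes in the contours is the one of `B9BlockSystemCubes` (any order gives an `IsBlockSystem`; [5]'s (52)–(53)
are not typed in the tree); no bound, no row head changes.

Sources: [Balaban1985RegularSpaces] (1.91) p. 91 [PDF 17], p. 77 (T_η); [Balaban1985BackgroundPropagators]
(3.18)–(3.19) p. 393, (3.23)–(3.25) p. 394, (3.162)–(3.165) p. 429 [PDF 5, 6, 41]; [Balaban1985Averaging] (2) p. 17.
-/

namespace Literature.MathematicalPhysics.QuantumFieldTheory.Balaban1983to89.B8Eq194CriterionCarriersWitness

open Finset Literature.MathematicalPhysics.QuantumFieldTheory.Balaban1983to89.B9Eq325Proj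
  Literature.MathematicalPhysics.QuantumFieldTheory.Balaban1983to89.B9Thm311Lattice
  Literature.MathematicalPhysics.QuantumFieldTheory.Balaban1983to89.B9BlockSystem1D
  Literature.MathematicalPhysics.QuantumFieldTheory.Balaban1983to89.B9BlockSystemCubes
  Literature.MathematicalPhysics.QuantumFieldTheory.Balaban1983to89.B9BlockSystemSigma
  Literature.MathematicalPhysics.QuantumFieldTheory.Balaban1983to89.B8Eq191Hprime
  Literature.MathematicalPhysics.QuantumFieldTheory.Balaban1983to89.B8Eq194FirstTerm
  Literature.MathematicalPhysics.QuantumFieldTheory.Balaban1983to89.B8Eq194CriterionLattice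
  Literature.MathematicalPhysics.QuantumFieldTheory.Balaban1983to89.B8Eq194CriterionFree
  Literature.MathematicalPhysics.QuantumFieldTheory.Balaban1983to89.B8Eq194CriterionCarriers
open scoped InnerProductSpace

/-! ## §1  Global coordinates: (block index, offset) ↦ site of the box -/

section Coords

variable (d K l : ℕ)

/-- The number of sites per direction, N = L·K with L = l + 1. [cite: Balaban1985BackgroundPropagators, (3.18) p. 393] -/
abbrev nSide : ℕ := (l + 1) * K

/-- Global coordinates x_i = c_i·L + r_i of the site with block index c and in-block offset r ([5] (2): the cube
B(y) = {x : y_μ ≤ x_μ < y_μ + L}). [cite: Balaban1985Averaging, (2) p. 17] -/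
def toSite (p : (Fin d → Fin K) × (Fin d → Fin (l + 1))) : Fin d → Fin (nSide K l) :=
  fun i => ⟨(p.1 i).val * (l + 1) + (p.2 i).val, by
    have hc := (p.1 i).isLt
    have hr := (p.2 i).isLt
    calc (p.1 i).val * (l + 1) + (p.2 i).val
        < (p.1 i).val * (l + 1) + (l + 1) := by omega
      _ = ((p.1 i).val + 1) * (l + 1) := by ring
      _ ≤ K * (l + 1) := Nat.mul_le_mul_right _ hc
      _ = (l + 1) * K := Nat.mul_comm _ _⟩

/-- (block index, offset) of a site: the block index is part 6's `boxBlk`, the offset the remainder.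
[cite: Balaban1985Averaging, (2) p. 17] -/
def toPair (x : Fin d → Fin (nSide K l)) : (Fin d → Fin K) × (Fin d → Fin (l + 1)) :=
  (boxBlk (l + 1) K rfl x, fun i => ⟨(x i).val % (l + 1), Nat.mod_lt _ (Nat.succ_pos l)⟩)

/-- Value of the global coordinate. [cite: Balaban1985Averaging, (2) p. 17] -/
theorem toSite_val (p : (Fin d → Fin K) × (Fin d → Fin (l + 1))) (i : Fin d) :
    (toSite d K l p i).val = (p.1 i).val * (l + 1) + (p.2 i).val := rfl

/-- The block of the site (c, r) is c. [cite: Balaban1985Averaging, (2) p. 17] -/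
theorem boxBlk_toSite (p : (Fin d → Fin K) × (Fin d → Fin (l + 1))) :
    boxBlk (l + 1) K rfl (toSite d K l p) = p.1 := by
  funext i
  apply Fin.ext
  show ((p.1 i).val * (l + 1) + (p.2 i).val) / (l + 1) = (p.1 i).val
  rw [Nat.mul_comm, Nat.mul_add_div (Nat.succ_pos l), Nat.div_eq_of_lt (p.2 i).isLt, add_zero]

/-- `toPair ∘ toSite = id`. [cite: Balaban1985Averaging, (2) p. 17] -/
theorem toPair_toSite (p : (Fin d → Fin K) × (Fin d → Fin (l + 1))) : toPair d K l (toSite d K l p) = p := by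
  refine Prod.ext (boxBlk_toSite d K l p) (funext fun i => Fin.ext ?_)
  show ((p.1 i).val * (l + 1) + (p.2 i).val) % (l + 1) = (p.2 i).val
  rw [Nat.mul_comm, Nat.mul_add_mod, Nat.mod_eq_of_lt (p.2 i).isLt]

/-- `toSite ∘ toPair = id`. [cite: Balaban1985Averaging, (2) p. 17] -/
theorem toSite_toPair (x : Fin d → Fin (nSide K l)) : toSite d K l (toPair d K l x) = x := by
  funext i
  apply Fin.ext
  show (x i).val / (l + 1) * (l + 1) + (x i).val % (l + 1) = (x i).val
  exact Nat.div_add_mod' _ _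

/-- An intra-cube bond ⟨(c, r), (c, r + e_μ)⟩ of `B9BlockSystemCubes` is the box bond ⟨x, x + e_μ⟩.
[cite: Balaban1985BackgroundPropagators, (3.19) p. 393, (3.23) p. 394] -/
theorem toSite_bond {a a' : (Fin d → Fin K) × (Fin d → Fin (l + 1))} (h : (a, a') ∈ bondsC d K l) :
    (toSite d K l a, toSite d K l a') ∈ boxBonds (Fin d) (nSide K l) := by
  rw [mem_bondsC] at h
  obtain ⟨h1, μ, hμ, hν⟩ := h
  rw [mem_boxBonds]
  refine ⟨μ, ?_, fun j hj => Fin.ext ?_⟩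
  · show (a'.1 μ).val * (l + 1) + (a'.2 μ).val = (a.1 μ).val * (l + 1) + (a.2 μ).val + 1
    rw [← h1, hμ, add_assoc]
  · show (a'.1 j).val * (l + 1) + (a'.2 j).val = (a.1 j).val * (l + 1) + (a.2 j).val
    rw [← h1, hν j hj]

/-- The block centres on the carriers: the cube corners y(c) = toSite (c, 0). [cite: Balaban1985Averaging, (2) p. 17] -/
def yBox (c : Fin d → Fin K) : Fin d → Fin (nSide K l) := toSite d K l (centreC d K l c)

/-- The contours Γ_{y(c),x} on the carriers: the image of the axis-by-axis contours `B9BlockSystemCubes.pathC`.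
[cite: Balaban1985BackgroundPropagators, (3.19) p. 393] -/
def ΓBox (c : Fin d → Fin K) (x : Fin d → Fin (nSide K l)) : List (Fin d → Fin (nSide K l)) :=
  (pathC d K l c (c, (toPair d K l x).2)).map (toSite d K l)

/-- helper: membership in `blocksOf`. [folklore] -/
private theorem mem_blocksOf' {X Y : Type*} [Fintype X] [DecidableEq Y] (blk : X → Y) (c : Y) (x : X) :
    x ∈ blocksOf blk c ↔ blk x = c := by
  unfold blocksOf
  simp only [mem_filter, mem_univ, true_and]

/-- The centre of block c lies in block c. [cite: Balaban1985Averaging, (2) p. 17] -/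
theorem boxBlk_yBox (c : Fin d → Fin K) : boxBlk (l + 1) K rfl (yBox d K l c) = c :=
  boxBlk_toSite d K l _

end Coords

/-! ## §2  The cube geometry is a block system for the box and torus bonds; the (3.25)-data exist -/

section BlockSystem

variable (d K l : ℕ)

/-- **The cubes of side L with corner centres and axis-by-axis contours form an `IsBlockSystem` for the box bonds**
(uniform weights κ ≠ 0). [cite: Balaban1985BackgroundPropagators, (3.18)-(3.19) p. 393; Balaban1985Averaging, (2) p. 17] -/
theorem isBlockSystem_box {κ : ℝ} (hκ : κ ≠ 0) :
    IsBlockSystem (boxBonds (Fin d) (nSide K l)) (fun _ _ => κ) (blocksOf (boxBlk (l + 1) K rfl))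
      (ΓBox d K l) (yBox d K l) where
  chain c x _ := by
    have hsp := (pathUp_spec d K l c (toPair d K l x).2 d le_rfl).1
    show List.IsChain (fun a a' => (a, a') ∈ boxBonds (Fin d) (nSide K l))
      (toSite d K l (centreC d K l c) :: (pathUp d K l c (toPair d K l x).2 d le_rfl).map (toSite d K l))
    rw [← List.map_cons]
    exact List.isChain_map_of_isChain (toSite d K l) (fun _ _ h => toSite_bond d K l h) hsp
  last c x hx := by
    have hc : boxBlk (l + 1) K rfl x = c := (mem_blocksOf' _ c x).1 hx
    have hsp := (pathUp_spec d K l c (toPair d K l x).2 d le_rfl).2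
    show (toSite d K l (centreC d K l c) :: (pathUp d K l c (toPair d K l x).2 d le_rfl).map (toSite d K l)).getLast
      (List.cons_ne_nil _ _) = x
    have e : toSite d K l (centreC d K l c) :: (pathUp d K l c (toPair d K l x).2 d le_rfl).map (toSite d K l)
        = (centreC d K l c :: pathUp d K l c (toPair d K l x).2 d le_rfl).map (toSite d K l) := rfl
    simp only [e, List.getLast_map, hsp, trunc_all]
    have hp : ((c, (toPair d K l x).2) : (Fin d → Fin K) × (Fin d → Fin (l + 1))) = toPair d K l x :=
      Prod.ext hc.symm rfl
    rw [hp, toSite_toPair]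
  sum_ne c := by
    rw [Finset.sum_const, nsmul_eq_mul]
    refine mul_ne_zero (Nat.cast_ne_zero.2 (Finset.card_pos.2 ⟨yBox d K l c, ?_⟩).ne') hκ
    exact (mem_blocksOf' _ c _).2 (boxBlk_yBox d K l c)
  cover x := ⟨boxBlk (l + 1) K rfl x, (mem_blocksOf' _ _ x).2 rfl⟩
  centre_mem c := (mem_blocksOf' _ c _).2 (boxBlk_yBox d K l c)
  centre_path c := by
    show (pathC d K l c (c, (toPair d K l (toSite d K l (centreC d K l c))).2)).map (toSite d K l) = []
    rw [toPair_toSite]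
    show (pathUp d K l c (zeroVec d l) d le_rfl).map (toSite d K l) = []
    rw [pathUp_zeroVec]
    rfl
  centre_wt _ := hκ
  disj c c' hne h := by
    have h' : boxBlk (l + 1) K rfl (yBox d K l c') = c := (mem_blocksOf' _ c _).1 h
    rw [boxBlk_yBox] at h'
    exact hne h'.symm

/-- … and for the torus bonds (monotonicity). [cite: Balaban1985BackgroundPropagators, (3.18)-(3.19) p. 393;
Balaban1985RegularSpaces, p. 77 (T_η)] -/
theorem isBlockSystem_torus {κ : ℝ} (hκ : κ ≠ 0) :
    IsBlockSystem (torusBonds (Fin d) (nSide K l)) (fun _ _ => κ) (blocksOf (boxBlk (l + 1) K rfl))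
      (ΓBox d K l) (yBox d K l) :=
  isBlockSystem_mono boxBonds_subset_torusBonds (isBlockSystem_box d K l hκ)

/-- **The (3.25)-data exist on the free box carriers** (every d, K, L = l + 1; uniform κ ≠ 0; a = diag(a_c), a_c > 0):
Δ′_a = Δ + Q′*aQ′ > 0, G′, (Q′G′²Q′*)⁻¹ as in Thm 3.11 «obvious», by part 4's `exists_data_flat`.
[cite: Balaban1985BackgroundPropagators, (3.24)-(3.25) p. 394, Thm 3.11 p. 416] -/
theorem exists_data_box {κ : ℝ} (hκ : κ ≠ 0) (a : (Fin d → Fin K) → ℝ) (ha : ∀ c, 0 < a c) :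
    ∃ (g : PiLp 2 (fun _ : Fin d → Fin (nSide K l) => ℝ) →ₗ[ℝ] PiLp 2 (fun _ : Fin d → Fin (nSide K l) => ℝ))
      (c : PiLp 2 (fun _ : Fin d → Fin K => ℝ) →ₗ[ℝ] PiLp 2 (fun _ : Fin d → Fin K => ℝ)),
      Data (lapL (flatT (Fin d → Fin (nSide K l))) (boxBonds (Fin d) (nSide K l)) (fun _ => 1))
        (qBox (l + 1) K rfl κ (ΓBox d K l) (yBox d K l))
        (LinearMap.adjoint (qBox (l + 1) K rfl κ (ΓBox d K l) (yBox d K l))) (AL a) g c :=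
  exists_data_flat (boxBlk (l + 1) K rfl) κ (fun _ => 1) (fun _ _ => zero_lt_one) (isBlockSystem_box d K l hκ) a ha

/-- **The (3.25)-data exist on the torus carriers.** [cite: Balaban1985BackgroundPropagators, (3.24)-(3.25) p. 394,
Thm 3.11 p. 416; Balaban1985RegularSpaces, p. 77 (T_η)] -/
theorem exists_data_torus {κ : ℝ} (hκ : κ ≠ 0) (a : (Fin d → Fin K) → ℝ) (ha : ∀ c, 0 < a c) :
    ∃ (g : PiLp 2 (fun _ : Fin d → Fin (nSide K l) => ℝ) →ₗ[ℝ] PiLp 2 (fun _ : Fin d → Fin (nSide K l) => ℝ))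
      (c : PiLp 2 (fun _ : Fin d → Fin K => ℝ) →ₗ[ℝ] PiLp 2 (fun _ : Fin d → Fin K => ℝ)),
      Data (lapL (flatT (Fin d → Fin (nSide K l))) (torusBonds (Fin d) (nSide K l)) (fun _ => 1))
        (qBox (l + 1) K rfl κ (ΓBox d K l) (yBox d K l))
        (LinearMap.adjoint (qBox (l + 1) K rfl κ (ΓBox d K l) (yBox d K l))) (AL a) g c :=
  exists_data_flat (boxBlk (l + 1) K rfl) κ (fun _ => 1) (fun _ _ => zero_lt_one) (isBlockSystem_torus d K l hκ)
    a ha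

end BlockSystem

/-! ## §3  Packaged: (1.91)'s H′ ≠ [4]'s (3.163) on the d-dimensional carriers -/

section Packaged

variable {d K l : ℕ}

/-- **Free box, L = l + 1 ≥ 2, K ≥ 2, d ≥ 1: for EVERY (3.25)-data with diagonal a (a_c ≠ 0) and any contours,
(1.91)'s H′ is NOT [4]'s H′ of (3.163)** (part 6's classification, negative direction).
[cite: Balaban1985RegularSpaces, (1.91) p. 91; Balaban1985BackgroundPropagators, (3.24)-(3.25) p. 394,
(3.163)-(3.165) p. 429] -/
theorem Hp_ne_H4_box (hd : 0 < d) (hl : 1 ≤ l) (hK : 2 ≤ K) {κ : ℝ} (hκ : κ ≠ 0)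
    (Γ : (Fin d → Fin K) → (Fin d → Fin (nSide K l)) → List (Fin d → Fin (nSide K l)))
    (y : (Fin d → Fin K) → Fin d → Fin (nSide K l)) (a : (Fin d → Fin K) → ℝ) (ha : ∀ c, a c ≠ 0)
    {g : PiLp 2 (fun _ : Fin d → Fin (nSide K l) => ℝ) →ₗ[ℝ] PiLp 2 (fun _ : Fin d → Fin (nSide K l) => ℝ)}
    {c : PiLp 2 (fun _ : Fin d → Fin K => ℝ) →ₗ[ℝ] PiLp 2 (fun _ : Fin d → Fin K => ℝ)}
    (hdata : Data (lapL (flatT (Fin d → Fin (nSide K l))) (boxBonds (Fin d) (nSide K l)) (fun _ => 1))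
      (qBox (l + 1) K rfl κ Γ y) (LinearMap.adjoint (qBox (l + 1) K rfl κ Γ y)) (AL a) g c) :
    ∃ μ, Hp (LinearMap.adjoint (qBox (l + 1) K rfl κ Γ y)) g c μ
      ≠ H4 (qBox (l + 1) K rfl κ Γ y) (LinearMap.adjoint (qBox (l + 1) K rfl κ Γ y)) (AL a) g c μ := by
  haveI : Nonempty (Fin d) := ⟨⟨0, hd⟩⟩
  refine exists_Hp_ne_H4_of_not_crit (boxBlk (l + 1) K rfl) hκ Γ y (boxBonds (Fin d) (nSide K l)) (fun _ => 1)
    (fun _ _ => zero_le_one) a ha (fun h => ?_) hdata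
  rcases (crit_box_carriers_iff (ι := Fin d) (N := nSide K l) (L := l + 1) (K := K) rfl (by omega) (by omega)).1 h
    with h1 | h1 <;> omega

/-- **Torus, L = l + 1 ≥ 2, K ≥ 2, (L, K) ≠ (2, 2), d ≥ 1: for EVERY (3.25)-data with diagonal a (a_c ≠ 0) and any
contours, (1.91)'s H′ is NOT [4]'s H′ of (3.163).** [cite: Balaban1985RegularSpaces, (1.91) p. 91, p. 77 (T_η);
Balaban1985BackgroundPropagators, (3.24)-(3.25) p. 394, (3.163)-(3.165) p. 429] -/
theorem Hp_ne_H4_torus (hd : 0 < d) (hl : 1 ≤ l) (hK : 2 ≤ K) (h22 : ¬ (l = 1 ∧ K = 2)) {κ : ℝ} (hκ : κ ≠ 0)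
    (Γ : (Fin d → Fin K) → (Fin d → Fin (nSide K l)) → List (Fin d → Fin (nSide K l)))
    (y : (Fin d → Fin K) → Fin d → Fin (nSide K l)) (a : (Fin d → Fin K) → ℝ) (ha : ∀ c, a c ≠ 0)
    {g : PiLp 2 (fun _ : Fin d → Fin (nSide K l) => ℝ) →ₗ[ℝ] PiLp 2 (fun _ : Fin d → Fin (nSide K l) => ℝ)}
    {c : PiLp 2 (fun _ : Fin d → Fin K => ℝ) →ₗ[ℝ] PiLp 2 (fun _ : Fin d → Fin K => ℝ)}
    (hdata : Data (lapL (flatT (Fin d → Fin (nSide K l))) (torusBonds (Fin d) (nSide K l)) (fun _ => 1))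
      (qBox (l + 1) K rfl κ Γ y) (LinearMap.adjoint (qBox (l + 1) K rfl κ Γ y)) (AL a) g c) :
    ∃ μ, Hp (LinearMap.adjoint (qBox (l + 1) K rfl κ Γ y)) g c μ
      ≠ H4 (qBox (l + 1) K rfl κ Γ y) (LinearMap.adjoint (qBox (l + 1) K rfl κ Γ y)) (AL a) g c μ := by
  haveI : Nonempty (Fin d) := ⟨⟨0, hd⟩⟩
  refine exists_Hp_ne_H4_of_not_crit (boxBlk (l + 1) K rfl) hκ Γ y (torusBonds (Fin d) (nSide K l)) (fun _ => 1)
    (fun _ _ => zero_le_one) a ha (fun h => ?_) hdata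
  rcases (crit_torus_carriers_iff (ι := Fin d) (N := nSide K l) (L := l + 1) (K := K) rfl (by omega) (by omega)).1 h
    with h1 | h1 | h1 <;> omega

/-- **Hypothesis-free: on the free box {0, …, LK − 1}^d with the printed cubes (corner centres, axis-by-axis contours),
L ≥ 2, K ≥ 2, d ≥ 1, the (3.25)-data EXIST and (1.91)'s H′ ≠ [4]'s (3.163) on them.**
[cite: Balaban1985RegularSpaces, (1.91) p. 91; Balaban1985BackgroundPropagators, (3.18)-(3.19) p. 393, (3.24)-(3.25)
p. 394, (3.163)-(3.165) p. 429] -/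
theorem exists_data_Hp_ne_H4_box (hd : 0 < d) (hl : 1 ≤ l) (hK : 2 ≤ K) {κ : ℝ} (hκ : κ ≠ 0)
    (a : (Fin d → Fin K) → ℝ) (ha : ∀ c, 0 < a c) :
    ∃ (g : PiLp 2 (fun _ : Fin d → Fin (nSide K l) => ℝ) →ₗ[ℝ] PiLp 2 (fun _ : Fin d → Fin (nSide K l) => ℝ))
      (c : PiLp 2 (fun _ : Fin d → Fin K => ℝ) →ₗ[ℝ] PiLp 2 (fun _ : Fin d → Fin K => ℝ)),
      Data (lapL (flatT (Fin d → Fin (nSide K l))) (boxBonds (Fin d) (nSide K l)) (fun _ => 1))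
          (qBox (l + 1) K rfl κ (ΓBox d K l) (yBox d K l))
          (LinearMap.adjoint (qBox (l + 1) K rfl κ (ΓBox d K l) (yBox d K l))) (AL a) g c ∧
        ∃ μ, Hp (LinearMap.adjoint (qBox (l + 1) K rfl κ (ΓBox d K l) (yBox d K l))) g c μ
          ≠ H4 (qBox (l + 1) K rfl κ (ΓBox d K l) (yBox d K l))
              (LinearMap.adjoint (qBox (l + 1) K rfl κ (ΓBox d K l) (yBox d K l))) (AL a) g c μ := by
  obtain ⟨g, c, hdata⟩ := exists_data_box d K l hκ a ha
  exact ⟨g, c, hdata, Hp_ne_H4_box hd hl hK hκ _ _ a (fun c => (ha c).ne') hdata⟩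

/-- **Hypothesis-free, torus: on (ℤ/(LK))^d with the printed cubes, L ≥ 2, K ≥ 2, (L, K) ≠ (2, 2), d ≥ 1, the
(3.25)-data EXIST and (1.91)'s H′ ≠ [4]'s (3.163) on them** (d = 1, (L, K) = (3, 2) is gen 7's `Witness6`).
[cite: Balaban1985RegularSpaces, (1.91) p. 91, p. 77 (T_η); Balaban1985BackgroundPropagators, (3.18)-(3.19) p. 393,
(3.24)-(3.25) p. 394, (3.163)-(3.165) p. 429] -/
theorem exists_data_Hp_ne_H4_torus (hd : 0 < d) (hl : 1 ≤ l) (hK : 2 ≤ K) (h22 : ¬ (l = 1 ∧ K = 2)) {κ : ℝ}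
    (hκ : κ ≠ 0) (a : (Fin d → Fin K) → ℝ) (ha : ∀ c, 0 < a c) :
    ∃ (g : PiLp 2 (fun _ : Fin d → Fin (nSide K l) => ℝ) →ₗ[ℝ] PiLp 2 (fun _ : Fin d → Fin (nSide K l) => ℝ))
      (c : PiLp 2 (fun _ : Fin d → Fin K => ℝ) →ₗ[ℝ] PiLp 2 (fun _ : Fin d → Fin K => ℝ)),
      Data (lapL (flatT (Fin d → Fin (nSide K l))) (torusBonds (Fin d) (nSide K l)) (fun _ => 1))
          (qBox (l + 1) K rfl κ (ΓBox d K l) (yBox d K l))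
          (LinearMap.adjoint (qBox (l + 1) K rfl κ (ΓBox d K l) (yBox d K l))) (AL a) g c ∧
        ∃ μ, Hp (LinearMap.adjoint (qBox (l + 1) K rfl κ (ΓBox d K l) (yBox d K l))) g c μ
          ≠ H4 (qBox (l + 1) K rfl κ (ΓBox d K l) (yBox d K l))
              (LinearMap.adjoint (qBox (l + 1) K rfl κ (ΓBox d K l) (yBox d K l))) (AL a) g c μ := by
  obtain ⟨g, c, hdata⟩ := exists_data_torus d K l hκ a ha
  exact ⟨g, c, hdata, Hp_ne_H4_torus hd hl hK h22 hκ _ _ a (fun c => (ha c).ne') hdata⟩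

end Packaged

end Literature.MathematicalPhysics.QuantumFieldTheory.Balaban1983to89.B8Eq194CriterionCarriersWitness
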